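import Summits.QuantumFields.YangMills.Theses.OnsetSkewLaw
import Summits.QuantumFields.YangMills.Theorems.BalabanLadderInfVolRPSeries
import Summits.QuantumFields.YangMills.Theorems.OnsetTautologyOnsetContraction
import HarnessLib

/-!
# Onset scales: joint continuity of the reflection-positivity squares in (resolution, offset)

Layer-2 lemma named in the thesis of route `OnsetSkewLaw` («the continuity/attainment lemma for amp», concrete half;
used by the glue `SkewFloorsGlue`, stmt-QuantumFields-23139).  For a compactly supported Schwartz bump `b`, an orientation
set `Q`, a state `μ` and a lattice datum `r`, the route's RP square
`rpSq Q s y = Σ' wr(p) wt(p') · stateMomentStr μ 2 (p, p')`, with weights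
`wt s y (q, x) = [q ∈ Q, q valid]·b(s(x + o_q) − y)` and `wr` its time-mirror, is JOINTLY CONTINUOUS in `(s, y)` on
`s > 0`: near any `(s, y)` the weights vanish off one finite box of sites (the support of `b` is compact, tree
`OnsetTautologyOnsetContraction.abs_coord_le_of_ne_zero`), so the series is locally a fixed finite sum of continuous functions.

THEOREMS ONLY.  Free-hands width seat `ym-line-sfw-p2-w4` (cell ym-idea-1); nothing about the Yang–Mills mass gap is
proved here.
-/

set_option autoImplicit false

noncomputable section

open scoped BigOperators
open MeasureTheory Filter Topology
open Literature.MathematicalPhysics.QuantumFieldTheory Literature.MathematicalPhysics.QuantumLattice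
open Literature.Probability.LatticeModels (Site)
open Summit.QuantumFields.YangMills.Theorems.InfiniteVolume (stateMomentStr)
open Summit.QuantumFields.YangMills.Theorems.InfVolRP (centreOffset norm_centreOffset_le_one)
open Summit.QuantumFields.YangMills.Theorems.OnsetTautologyOnsetContraction (abs_coord_le_of_ne_zero)

namespace Summit.QuantumFields.YangMills.Theorems.OnsetSkewLawGlue

variable {G : Type} [Group G] [TopologicalSpace G] [IsTopologicalGroup G] [CompactSpace G]
  [MeasurableSpace G] [BorelSpace G]

/-- **A uniform support box.**  For `b` compactly supported, `s₀ > 0` and `Y`, there is ONE finite set `S` of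
(orientation, site) pairs off which both atom weights vanish for every resolution `s > s₀` and every offset `‖z‖ < Y`.
[folklore] -/
theorem exists_support_box (b : EuclideanSpace ℝ (Fin 4) → ℝ) (hb : HasCompactSupport b)
    (Q : Finset (Fin 4 × Fin 4)) {s₀ : ℝ} (hs₀ : 0 < s₀) (Y : ℝ) :
    ∃ S : Finset ((Fin 4 × Fin 4) × Site 4), ∀ (s : ℝ), s₀ < s → ∀ z : EuclideanSpace ℝ (Fin 4), ‖z‖ < Y →
      ∀ p : (Fin 4 × Fin 4) × Site 4, p ∉ S →
        (if p.1 ∈ Q ∧ p.1.1 < p.1.2 then b (s • (siteToE p.2 + centreOffset p.1) - z) else 0) = 0 ∧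
        (if p.1 ∈ Q ∧ p.1.1 < p.1.2 then b (timeReflection 4 (s • (siteToE p.2 + centreOffset p.1)) - z) else 0) = 0 := by
  obtain ⟨R, hR0, hR⟩ : ∃ R : ℝ, 0 ≤ R ∧ Function.support b ⊆ Metric.closedBall 0 R := by
    obtain ⟨R, hR⟩ := (hb.isCompact.isBounded).subset_closedBall (0 : EuclideanSpace ℝ (Fin 4))
    refine ⟨max R 0, le_max_right _ _, (subset_tsupport _).trans (hR.trans ?_)⟩
    exact Metric.closedBall_subset_closedBall (le_max_left _ _)
  set B : ℕ := ⌈(R + |Y|) / s₀ + 1⌉₊ with hB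
  refine ⟨Finset.univ ×ˢ Fintype.piFinset (fun _ : Fin 4 => Finset.Icc (-(B : ℤ)) B), ?_⟩
  intro s hs z hz p hp
  have hs' : 0 < s := hs₀.trans hs
  have key : ∀ w : EuclideanSpace ℝ (Fin 4), ‖w‖ = ‖s • (siteToE p.2 + centreOffset p.1)‖ → b (w - z) = 0 := by
    intro w hw
    by_contra hne
    refine hp ?_
    simp only [Finset.mem_product, Finset.mem_univ, true_and, Fintype.mem_piFinset, Finset.mem_Icc]
    intro i
    have h := abs_coord_le_of_ne_zero hR hs' (norm_centreOffset_le_one p.1) p.2 z w hw hne i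
    have hmono : (R + ‖z‖) / s + 1 ≤ (R + |Y|) / s₀ + 1 := by
      have hz' : ‖z‖ ≤ |Y| := hz.le.trans (le_abs_self Y)
      have h1 : (R + ‖z‖) / s ≤ (R + |Y|) / s :=
        div_le_div_of_nonneg_right (by linarith) hs'.le
      have h2 : (R + |Y|) / s ≤ (R + |Y|) / s₀ :=
        div_le_div_of_nonneg_left (by positivity) hs₀ hs.le
      linarith
    have h1 : |(p.2 i : ℝ)| ≤ (B : ℝ) := (h.trans hmono).trans (Nat.le_ceil _)
    have h2 : |p.2 i| ≤ (B : ℤ) := by exact_mod_cast h1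
    exact abs_le.1 h2
  refine ⟨?_, ?_⟩
  · by_cases hq : p.1 ∈ Q ∧ p.1.1 < p.1.2
    · rw [if_pos hq]; exact key _ rfl
    · rw [if_neg hq]
  · by_cases hq : p.1 ∈ Q ∧ p.1.1 < p.1.2
    · rw [if_pos hq]; exact key _ (LinearIsometryEquiv.norm_map _ _)
    · rw [if_neg hq]

omit [IsTopologicalGroup G] [CompactSpace G] [BorelSpace G] in
/-- **Joint continuity of the RP square in (resolution, offset) on `s > 0`.**  The route's double series
`Σ' wr(p) wt(p') · stateMomentStr μ 2 (p, p')` is continuous at every `(s, y)` with `s > 0`: locally it is a fixed finite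
sum (`exists_support_box`) of continuous functions. [folklore] -/
theorem continuousAt_rpSq (r : LatticeRep G) (μ : Measure (LGConfig 4 G)) (b : EuclideanSpace ℝ (Fin 4) → ℝ)
    (hbc : Continuous b) (hb : HasCompactSupport b) (Q : Finset (Fin 4 × Fin 4)) {s : ℝ} (hs : 0 < s)
    (y : EuclideanSpace ℝ (Fin 4)) :
    ContinuousAt (fun sy : ℝ × EuclideanSpace ℝ (Fin 4) =>
      ∑' pp : ((Fin 4 × Fin 4) × (Fin 4 → ℤ)) × ((Fin 4 × Fin 4) × (Fin 4 → ℤ)),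
        (if pp.1.1 ∈ Q ∧ pp.1.1.1 < pp.1.1.2 then
            b (timeReflection 4 (sy.1 • (siteToE pp.1.2 + centreOffset pp.1.1)) - sy.2) else 0) *
          (if pp.2.1 ∈ Q ∧ pp.2.1.1 < pp.2.1.2 then
            b (sy.1 • (siteToE pp.2.2 + centreOffset pp.2.1) - sy.2) else 0) *
          stateMomentStr G r μ 2 ![pp.1.1, pp.2.1] ![pp.1.2, pp.2.2]) (s, y) := by
  -- one support box for the whole neighbourhood `s/2 < s' ∧ ‖y'‖ < ‖y‖ + 1`
  obtain ⟨S, hS⟩ := exists_support_box b hb Q (half_pos hs) (‖y‖ + 1)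
  set N : Set (ℝ × EuclideanSpace ℝ (Fin 4)) := {sy | s / 2 < sy.1 ∧ ‖sy.2‖ < ‖y‖ + 1} with hN
  have hNopen : IsOpen N :=
    (isOpen_lt continuous_const continuous_fst).inter (isOpen_lt (continuous_norm.comp continuous_snd) continuous_const)
  have hNmem : (s, y) ∈ N := ⟨by simp only; linarith, by simp only; linarith⟩
  -- the finite sum
  set F : ℝ × EuclideanSpace ℝ (Fin 4) → ℝ := fun sy =>
    ∑ pp ∈ S ×ˢ S,
      (if pp.1.1 ∈ Q ∧ pp.1.1.1 < pp.1.1.2 then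
          b (timeReflection 4 (sy.1 • (siteToE pp.1.2 + centreOffset pp.1.1)) - sy.2) else 0) *
        (if pp.2.1 ∈ Q ∧ pp.2.1.1 < pp.2.1.2 then
          b (sy.1 • (siteToE pp.2.2 + centreOffset pp.2.1) - sy.2) else 0) *
        stateMomentStr G r μ 2 ![pp.1.1, pp.2.1] ![pp.1.2, pp.2.2] with hF
  have hFcont : Continuous F := by
    refine continuous_finsetSum _ fun pp _ => ?_
    refine Continuous.mul (Continuous.mul ?_ ?_) continuous_const
    · by_cases hq : pp.1.1 ∈ Q ∧ pp.1.1.1 < pp.1.1.2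
      · simp only [hq, and_self, if_true]
        exact hbc.comp (((timeReflection 4).continuous.comp (continuous_fst.smul continuous_const)).sub
          continuous_snd)
      · simp only [hq, if_false]; exact continuous_const
    · by_cases hq : pp.2.1 ∈ Q ∧ pp.2.1.1 < pp.2.1.2
      · simp only [hq, and_self, if_true]
        exact hbc.comp ((continuous_fst.smul continuous_const).sub continuous_snd)
      · simp only [hq, if_false]; exact continuous_const
  -- on `N` the series is the finite sum
  have hEq : ∀ sy ∈ N, (∑' pp : ((Fin 4 × Fin 4) × (Fin 4 → ℤ)) × ((Fin 4 × Fin 4) × (Fin 4 → ℤ)),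
        (if pp.1.1 ∈ Q ∧ pp.1.1.1 < pp.1.1.2 then
            b (timeReflection 4 (sy.1 • (siteToE pp.1.2 + centreOffset pp.1.1)) - sy.2) else 0) *
          (if pp.2.1 ∈ Q ∧ pp.2.1.1 < pp.2.1.2 then
            b (sy.1 • (siteToE pp.2.2 + centreOffset pp.2.1) - sy.2) else 0) *
          stateMomentStr G r μ 2 ![pp.1.1, pp.2.1] ![pp.1.2, pp.2.2]) = F sy := by
    intro sy hsy
    rw [hF]
    refine tsum_eq_sum fun pp hpp => ?_
    rw [Finset.mem_product, not_and_or] at hpp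
    rcases hpp with h1 | h2
    · rw [(hS sy.1 hsy.1 sy.2 hsy.2 pp.1 h1).2, zero_mul, zero_mul]
    · rw [(hS sy.1 hsy.1 sy.2 hsy.2 pp.2 h2).1, mul_zero, zero_mul]
  refine (hFcont.continuousAt).congr ?_
  exact Filter.eventuallyEq_of_mem (hNopen.mem_nhds hNmem) fun sy hsy => (hEq sy hsy).symm

end Summit.QuantumFields.YangMills.Theorems.OnsetSkewLawGlue

end
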